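import Summits.MatrixMultiplication.MatrixMultiplication.Theorems.SoloInformedTwistedMatchingsEffectivePrimePow
import Summits.MatrixMultiplication.MatrixMultiplication.Theorems.SoloInformedTranslationSchemes
import HarnessLib

/-!
# Effective Theorem B″ at exponent `4`: translation schemes over `ℤ/4`-modules

Solo-informed seat (MatrixMultiplication), gen 101; sharpest-statement §2y(8), effective form beyond `𝔽_p^k`.
`S` a finite abelian group of exponent dividing `4` (e.g. the additive group of a Galois ring `GR(4,r)`, or
`(ℤ/4)^a × (ℤ/2)^b`), `M₀ ≤ Aut S` arbitrary, `c` an orbit labelling, `A, B, Γ : [3N]² → C` a realization of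
`⟨3N,3N,3N⟩` in the translation scheme `𝒮(S, M₀)` (Cohn–Umans 2013 Def. 11/12). Then
`N² e^{-4√(log N)} ≤ 3 |S|^{19/20} ≤ 3 (|C|·|M₀|)^{19/20}` (`translationScheme_exp_four_card_ge_behrend`;
realization form `realization_exp_four_card_ge_behrend`), from `twistedMatching_card_le_exp_four`.
So rank·`|M₀| ≥ n^{2.10 - o(1)}` along translation schemes over exponent-`4` hosts.
References: CohnUmans2013 (arXiv:1207.6528) Def. 11/12, Conj. 21; BCCGNSU17 (arXiv:1605.06702).
-/

noncomputable section

open scoped BigOperators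
open Finset

namespace Summit.MatrixMultiplication.MatrixMultiplication.Theorems.TwistedSliceRank

section ExpFourHeadline

/-- **Exponent-4 hosts, realization form.** A Cohn–Umans Def. 12 realization of `⟨3N,3N,3N⟩` by the
twisted triangle predicate of finitely many automorphism pairs of an abelian group of exponent dividing `4`
forces `N² e^{-4√(log N)} ≤ 3 |S|^{19/20}`. [this work] -/
theorem realization_exp_four_card_ge_behrend (S : Type) [CommGroup S] [Fintype S] [DecidableEq S]
    (hexpS : ∀ g : S, g ^ 4 = 1) (σ : Type) [Fintype σ] (φ ψ : σ → S ≃* S) (N : ℕ)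
    (α β γ : Fin (3 * N) × Fin (3 * N) → S)
    (hreal : ∀ x y z : Fin (3 * N) × Fin (3 * N),
      (∃ s : σ, α x * φ s (β y) * ψ s (γ z) = 1) ↔ (y.1 = x.2 ∧ z = (y.2, x.1))) :
    ((N : ℝ) ^ 2 * Real.exp (-4 * Real.sqrt (Real.log N))) ≤
      3 * (Fintype.card S : ℝ) ^ (19 / 20 : ℝ) := by
  obtain ⟨t, htN, htcard, ht⟩ := rothNumberNat_spec N
  obtain ⟨a, b, c, -, hind⟩ := threeAPFree_inducedMatching ht htN
  have hmatch : ∀ i j l : ↥t × Fin N,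
      (∃ s : σ, α (a i, b i) * φ s (β (b j, c j)) * ψ s (γ (c l, a l)) = 1) ↔ (i = j ∧ j = l) := by
    intro i j l
    rw [hreal (a i, b i) (b j, c j) (c l, a l)]
    constructor
    · rintro ⟨h1, h2⟩
      simp only [Prod.mk.injEq] at h2
      exact hind i j l h1 h2.1 h2.2
    · rintro ⟨rfl, rfl⟩
      exact ⟨rfl, rfl⟩
  have h := twistedMatching_card_le_exp_four S hexpS σ φ ψ (↥t × Fin N)
    (fun i => α (a i, b i)) (fun j => β (b j, c j)) (fun l => γ (c l, a l)) hmatch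
  have hcard : Fintype.card (↥t × Fin N) = rothNumberNat N * N := by
    rw [Fintype.card_prod, Fintype.card_coe, htcard, Fintype.card_fin]
  rw [hcard] at h
  push_cast at h
  have hB : (N : ℝ) * Real.exp (-4 * Real.sqrt (Real.log N)) ≤ rothNumberNat N :=
    Behrend.roth_lower_bound
  have hN : (0 : ℝ) ≤ N := Nat.cast_nonneg N
  calc (N : ℝ) ^ 2 * Real.exp (-4 * Real.sqrt (Real.log N))
      = ((N : ℝ) * Real.exp (-4 * Real.sqrt (Real.log N))) * N := by ring
    _ ≤ (rothNumberNat N : ℝ) * N := mul_le_mul_of_nonneg_right hB hN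
    _ ≤ _ := h

/-- **Exponent-4 hosts, translation-scheme form.** A realization of `⟨3N,3N,3N⟩` in `𝒮(S, M₀)`
(CU13 Def. 11/12), `S` abelian of exponent dividing `4`, `M₀ ≤ Aut S` arbitrary, forces
`N² e^{-4√(log N)} ≤ 3 (|C|·|M₀|)^{19/20}` (`|C|` = number of orbit labels ≥ rank). [this work] -/
theorem translationScheme_exp_four_card_ge_behrend (S : Type) [CommGroup S] [Fintype S]
    [DecidableEq S] (hexpS : ∀ g : S, g ^ 4 = 1) (M₀ : Subgroup (MulAut S)) [Fintype M₀]
    (C : Type) [Fintype C] [DecidableEq C] (c : S → C)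
    (hc : ∀ g h : S, c g = c h ↔ ∃ φ : M₀, (φ : MulAut S) g = h) (N : ℕ)
    (A B Γ : Fin (3 * N) × Fin (3 * N) → C)
    (hreal : ∀ x y z : Fin (3 * N) × Fin (3 * N),
      (∃ g h l : S, c g = A x ∧ c h = B y ∧ c l = Γ z ∧ g * h * l = 1) ↔
        (y.1 = x.2 ∧ z = (y.2, x.1))) :
    ((N : ℝ) ^ 2 * Real.exp (-4 * Real.sqrt (Real.log N))) ≤
      3 * ((Fintype.card C : ℝ) * Fintype.card M₀) ^ (19 / 20 : ℝ) := by
  have hSC : (Fintype.card S : ℝ) ≤ (Fintype.card C : ℝ) * Fintype.card M₀ := by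
    exact_mod_cast card_le_card_labels_mul M₀ c hc
  have hmono : 3 * (Fintype.card S : ℝ) ^ (19 / 20 : ℝ) ≤
      3 * ((Fintype.card C : ℝ) * Fintype.card M₀) ^ (19 / 20 : ℝ) := by
    gcongr
  refine le_trans ?_ hmono
  rcases Nat.eq_zero_or_pos N with hN | hN
  · subst hN
    simp only [Nat.cast_zero, ne_eq, OfNat.ofNat_ne_zero, not_false_eq_true, zero_pow, zero_mul]
    positivity
  have w : Fin (3 * N) := ⟨0, by omega⟩
  have hA : ∀ x, ∃ g : S, c g = A x := fun x => by
    obtain ⟨g, h, l, hg, -, -, -⟩ := (hreal x (x.2, w) (w, x.1)).2 ⟨rfl, rfl⟩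
    exact ⟨g, hg⟩
  have hB : ∀ y, ∃ g : S, c g = B y := fun y => by
    obtain ⟨g, h, l, -, hh, -, -⟩ := (hreal (w, y.1) y (y.2, w)).2 ⟨rfl, rfl⟩
    exact ⟨h, hh⟩
  have hΓ : ∀ z, ∃ g : S, c g = Γ z := fun z => by
    obtain ⟨g, h, l, -, -, hl, -⟩ := (hreal (z.2, w) (w, z.1) z).2 ⟨rfl, Prod.ext rfl rfl⟩
    exact ⟨l, hl⟩
  choose α hα using hA
  choose β hβ using hB
  choose γ hγ using hΓ
  refine realization_exp_four_card_ge_behrend S hexpS (↥M₀ × ↥M₀)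
    (fun s => (s.1 : MulAut S)) (fun s => (s.2 : MulAut S)) N α β γ (fun x y z => ?_)
  rw [← hreal x y z]
  exact (triangle_iff_twisted M₀ c hc (hα x) (hβ y) (hγ z)).symm

end ExpFourHeadline

end Summit.MatrixMultiplication.MatrixMultiplication.Theorems.TwistedSliceRank
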